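import Literature.AlgebraicGeometry.AbelianSchemes.AbelianLiftObstructionClassTwoAtlases
import Literature.AlgebraicGeometry.AbelianSchemes.AbelianVarietyCechInversionH2
import Literature.AlgebraicGeometry.Deformation.SmoothLiftAtlasTransportFrameQuot
import Literature.AlgebraicGeometry.Deformation.SmoothLiftAtlasTransportQuot
import Literature.AlgebraicGeometry.AbelianSchemes.AbelianLiftObstructionAutTransport
import Literature.AlgebraicGeometry.Deformation.SmoothLiftCocycleAtlasOfClassZeroQuot
import Literature.AlgebraicGeometry.AbelianSchemes.AbelianVarietyCechInversionAntisymmetricVanishing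
import Literature.AlgebraicGeometry.Morphisms.CechModuleH2FrameCoordinates
import Literature.AlgebraicGeometry.AbelianSchemes.AbelianVarietyInversionTangentGlobal
import Literature.AlgebraicGeometry.HodgeTheory.TangentSheafSectionsDerivations
import HarnessLib

/-!
# The lift obstruction of an abelian scheme vanishes when `2` is a unit ([Oort1971] Thm. (2.2.1), FIRST proof, pp. 279–280)

Layer `Literature/AlgebraicGeometry/AbelianSchemes`, namespace `Literature.AlgebraicGeometry.AbelianSchemes.AbelianSchemeOver`.
PROOF FILE (cell `hodgecm-mathlib`, P6 sub-desk P6b, (U-ab) plate organ **(O6) ASSEMBLER**, LEAD «M-140a» (2); count-neutral ★ capital on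
`--supports stmt-HodgeConjecture-24832`; no definition, no instance, no notation, no named fact; sorry-free, kernel-checked).

* §0 `CechMH2.mk_refine_eq_neg_of_coordC2` — from `[ρ_{τ′} o′] = [ρ_τ o]` and `ρ_{τ′}(π_j o′) = −ρ_{τ′} c₃` to `[ρ_{τ′} c₃] = −[ρ_τ(π_j o)]`
  (★ (S4) frame coordinates `coordC2`); `Sections.res_appLE_eq_res_comap` (Mathlib `Scheme.Hom.appLE_map`).
* §0b `map_appLE_map_top_dSection` (restriction naturality of `θ|_Y(dy)` for a global field), `appLE_dSection_eq_neg_of_eq_appLE_inv`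
  (★ (O2) `appLE_dSection_app_inv_eq_neg` moved to an open `W′ ⊆ ι⁻¹W` along a map agreeing with `ι♯`).
* `liftObstructionVanishes_of_isUnit_two` — THE HEAD (boxed sigtwin e92d1d75, statement byte-identical).

THE PRINT. [Oort1971, Thm. (2.2.1) (p. 273), first proof (pp. 279–280)]: the obstruction `D(X′; R → R′) ∈ H²(X_k, Θ) ⊗ J` to lifting the
abelian scheme is carried to itself by every automorphism of the lifting situation, in particular by the inversion `-1`; `Θ_{X_k}` is free on the
invariant vector fields on which `-1` acts by `-1`, and `-1` acts trivially on `H²(X_k, 𝒪) = ∧² H¹(X_k, 𝒪)`; hence `D = -D`, and `D = 0` when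
`2` is invertible («if char(k) ≠ 2, this proves the obstruction vanishes»).  HERE: the (U-ab) CONTRACT ★ (D) `LiftObstructionVanishes hJ hmJ φ X₀`
discharged from `IsUnit (2 : A)` and the `H¹`-COUNT of the closed fibre (`hH1`, the letter of ★ (O4) B
`cechMH2_mk_refine_comap_inv_of_finrank_cechH1`; ★ in residue characteristic `0` and ★ from Poincaré∕DUALS-letter data, NOT ★ for a bare abelian
variety in characteristic `p` — HONEST LABEL: conditional on `hH1`).  Road: the transported datum along `ι₀ = [-1]` (★ (vii-d) p852682) is a second
datum; ★ (O5) p852742 compares the two refined classes on a common refinement; ★ (O1)∕(O3) p852779 + (O2) put the transported cochain in frame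
coordinates as MINUS the comap of the coordinates; ★ (O4) B makes `[-1]^*` the identity on each `𝒪`-coordinate class; so `2·[ρ o] = 0`,
`[ρ o] = 0` (`2 ∈ κ(A)ˣ`), and `[o] = 0` by refinement injectivity on the closed fibre.

HC_CM is proved only modulo the printed citations until rung 0 closes; nothing here bears on a summit statement.
## References
* [Oort1971] F. Oort, *Finite group schemes, local moduli for abelian varieties, and lifting problems*, Compositio Math. 23 (1971), Thm. (2.2.1)
  (p. 273) and its first proof (pp. 279–280).
* [MumfordAV1970] D. Mumford, *Abelian Varieties* (1970), §4 (iii) (p. 42), §13 Cor. 2 (p. 129).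
* [Hartshorne2010] R. Hartshorne, *Deformation Theory*, GTM 257, Springer (2010): Thm. 10.2 (a) and its proof (p. 81), Cor. 10.3 (a) (p. 82).
-/

noncomputable section

set_option backward.isDefEq.respectTransparency false

open CategoryTheory CategoryTheory.Limits AlgebraicGeometry TopologicalSpace Opposite
open scoped TensorProduct
open Literature.AlgebraicGeometry.Morphisms Literature.AlgebraicGeometry.HodgeTheory Literature.AlgebraicGeometry.Modules
  Literature.AlgebraicGeometry.Motives
open Literature.AlgebraicGeometry.Deformation.AtlasQuot Literature.AlgebraicGeometry.Deformation.CanonicalLiftQuot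
  Literature.AlgebraicGeometry.Deformation.LiftableCoverQuot Literature.AlgebraicGeometry.Deformation.LiftObstructionCocycleQuot
  Literature.AlgebraicGeometry.Deformation.ExtensionAutomorphismsQuot Literature.AlgebraicGeometry.Deformation.LiftObstructionCechClassQuot
  Literature.AlgebraicGeometry.Deformation.LiftObstructionClassAtlasQuot Literature.AlgebraicGeometry.Deformation.LiftClosedFibreDictionaryQuot
  Literature.AlgebraicGeometry.Deformation.LiftOfClassZeroAtlasQuot Literature.AlgebraicGeometry.Deformation.AtlasTransportQuot
  Literature.AlgebraicGeometry.Deformation.AtlasTransportClassQuot Literature.AlgebraicGeometry.Deformation.AtlasTransportFrameQuot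

namespace Literature.AlgebraicGeometry.AbelianSchemes.AbelianSchemeOver

variable {A : Type} [CommRing A] [IsArtinianRing A] [IsLocalRing A] {J : Ideal A}

/-! ## §0 Čech bookkeeping: the antisymmetry letter from the two-atlas comparison and the frame coordinates -/

/-- **From `[ρ_{τ′} o′] = [ρ_τ o]` (two data, `E`-valued classes on a common refinement) to the `(O4c)` letter per frame coordinate:**
if the `j`-th coordinate of `o′` refines to MINUS the refinement of a cochain `c₃` on a third family (the comap of the `j`-th coordinate of
`o`), then `[ρ_{τ′} c₃] = −[ρ_τ (π_j o)]` in `Ȟ²(𝒲; 𝒪)`. [cite: Oort1971, proof of Thm. (2.2.1), pp. 279–280] -/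
theorem CechMH2.mk_refine_eq_neg_of_coordC2 {k : Type} [CommRing k] {X : Scheme.{0}} (f : X ⟶ Spec (.of k))
    {I : Type} [Fintype I] {E : X.Modules} (e : E ≅ SheafOfModules.free (R := X.ringCatSheaf) I)
    {ι₁ ι₂ ι₃ : Type} (U₁ : ι₁ → X.Opens) (U₂ : ι₂ → X.Opens) (U₃ : ι₂ → X.Opens) (W : ι₃ → X.Opens)
    (τ : ι₃ → ι₁) (τ' : ι₃ → ι₂) (hτ₁ : ∀ s, W s ≤ U₁ (τ s)) (hτ₂ : ∀ s, W s ≤ U₂ (τ' s)) (hτ₃ : ∀ s, W s ≤ U₃ (τ' s))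
    (o : cechMZ2 f E U₁) (o' : cechMZ2 f E U₂)
    (hcls : CechMH2.mk f E W ⟨cechMRefineC2 f E U₂ W τ' hτ₂ (o' : CechMC2 f E U₂), refineMC2_mem_cechMZ2 f E U₂ W τ' hτ₂ o'.2⟩ =
      CechMH2.mk f E W ⟨cechMRefineC2 f E U₁ W τ hτ₁ (o : CechMC2 f E U₁), refineMC2_mem_cechMZ2 f E U₁ W τ hτ₁ o.2⟩)
    (j : I) (c₃ : CechMC2 f (unitModule X) U₃) (hc₃ : c₃ ∈ cechMZ2 f (unitModule X) U₃)
    (hcoef : cechMRefineC2 f (unitModule X) U₂ W τ' hτ₂ (coordC2 f e U₂ j (o' : CechMC2 f E U₂)) =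
      -cechMRefineC2 f (unitModule X) U₃ W τ' hτ₃ c₃) :
    CechMH2.mk f (unitModule X) W ⟨cechMRefineC2 f (unitModule X) U₃ W τ' hτ₃ c₃, refineMC2_mem_cechMZ2 f _ U₃ W τ' hτ₃ hc₃⟩ =
      -CechMH2.mk f (unitModule X) W ⟨cechMRefineC2 f (unitModule X) U₁ W τ hτ₁ (coordC2 f e U₁ j (o : CechMC2 f E U₁)),
        refineMC2_mem_cechMZ2 f _ U₁ W τ hτ₁ (coordC2_mem_cechMZ2 f e U₁ j o.2)⟩ := by
  -- the `j`-th coordinates of the two refined classes agree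
  have hB : cechMRefineC2 f E U₂ W τ' hτ₂ (o' : CechMC2 f E U₂) - cechMRefineC2 f E U₁ W τ hτ₁ (o : CechMC2 f E U₁) ∈
      cechMB2 f E W := (CechMH2.mk_eq_mk_iff f E W _ _).1 hcls
  have hBj := coordC2_mem_cechMB2 f e W j hB
  rw [map_sub, coordC2_refineC2, coordC2_refineC2, hcoef] at hBj
  -- `-ρ′ c₃ - ρ (π_j o) ∈ B²`, i.e. `[ρ′ c₃] = -[ρ (π_j o)]`
  rw [eq_neg_iff_add_eq_zero, ← map_add, CechMH2.mk_eq_zero_iff]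
  have h2 : -cechMRefineC2 f (unitModule X) U₃ W τ' hτ₃ c₃ -
      cechMRefineC2 f (unitModule X) U₁ W τ hτ₁ (coordC2 f e U₁ j (o : CechMC2 f E U₁)) =
      -(cechMRefineC2 f (unitModule X) U₃ W τ' hτ₃ c₃ +
        cechMRefineC2 f (unitModule X) U₁ W τ hτ₁ (coordC2 f e U₁ j (o : CechMC2 f E U₁))) := by abel
  rw [h2] at hBj
  exact (Submodule.neg_mem_iff _).1 hBj

/-- **Restriction after the fibre map's `appLE` is restriction after `Sections.comap`** (both are `appLE` to the smaller open,
Mathlib `Scheme.Hom.appLE_map`); used to identify `ρ ∘ s̄` with `ρ′ ∘ ι_κ^♯`. [folklore] -/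
private theorem Sections.res_appLE_eq_res_comap {k : Type} [CommRing k] {X Y : Scheme.{0}} (fX : X ⟶ Spec (.of k))
    (fY : Y ⟶ Spec (.of k)) (g : Y ⟶ X) (hg : g ≫ fX = fY) {U : X.Opens} {V V' W : Y.Opens} (e : V ≤ g ⁻¹ᵁ U)
    (e' : V' ≤ g ⁻¹ᵁ U) (h : W ≤ V) (h' : W ≤ V') (c : Γ(X, U)) :
    Sections.res fY h (g.appLE U V e c) = Sections.res fY h' (Sections.comap fX fY g hg e' c) := by
  change (g.appLE U V e ≫ Y.presheaf.map (homOfLE h).op) c = (g.appLE U V' e' ≫ Y.presheaf.map (homOfLE h').op) c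
  rw [Scheme.Hom.appLE_map, Scheme.Hom.appLE_map]

/-! ## §0b The (O2) letter moved to the transported face: restriction naturality of `θ|_Y(dy)` for a global field `θ` -/

/-- **Restriction naturality of `θ|_Y(d y)` for a GLOBAL section `θ` of `𝒯`**: `(θ|_Y(dy))|_{Y′} = θ|_{Y′}(d(y|_{Y′}))` for `Y′ ⊆ Y`
(★ `map_appLE_dSection` + `appLE_restrictHom`). [cite: Hartshorne1977, II.8 p. 175 (compatibility of `d` with localisation)] -/
theorem map_appLE_map_top_dSection {S : Type} [CommRing S] (X : Over (Spec (CommRingCat.of S))) (θ : Γ(tangentSheaf X, ⊤))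
    {Y Y' : X.left.Opens} (q : Y' ≤ Y) (y : Γ(X.left, Y)) :
    X.left.presheaf.map (homOfLE q).op
        (show Γ(X.left, Y) from appLE ((tangentSheaf X).presheaf.map (homOfLE (le_top : Y ≤ ⊤)).op θ) (𝟙 _) (dSection X Y y)) =
      (show Γ(X.left, Y') from
        appLE ((tangentSheaf X).presheaf.map (homOfLE (le_top : Y' ≤ ⊤)).op θ) (𝟙 _)
          (dSection X Y' (X.left.presheaf.map (homOfLE q).op y))) := by
  have h := map_appLE_dSection (homOfLE q) (restrictHom (homOfLE (le_top : Y ≤ ⊤)) θ) y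
  rw [appLE_restrictHom, appLE_restrictHom, appLE_restrictHom] at h
  exact h.trans (appLE_congr_hom θ _ _ _)

/-- **The (O2) letter on a smaller open**: for an abelian scheme `B` over a field, a global field `θ`, opens `W′ ⊆ ι⁻¹W` (`ι = [-1]_B`) and
any map `s` agreeing with `ι♯ : Γ(W) → Γ(W′)` (`Scheme.Hom.appLE`): `θ|_{W′}(d(s c)) = −s(θ|_W(dc))` (★ (O2) `appLE_dSection_app_inv_eq_neg`
restricted along `W′ ⊆ ι⁻¹W`). [cite: Oort1971, §2.2 (pp. 277–280)] [cite: MumfordAV1970, §4 (iii) (p. 42)] -/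
theorem appLE_dSection_eq_neg_of_eq_appLE_inv {k : Type} [Field k] (B : AbelianSchemeOver (Spec (.of k)))
    (θ : Γ(tangentSheaf B.X, ⊤)) (W W' : B.X.left.Opens) (p : W' ≤ (GrpObj.inv : B.X ⟶ B.X).left ⁻¹ᵁ W)
    (s : Γ(B.X.left, W) → Γ(B.X.left, W')) (hs : ∀ x, s x = (GrpObj.inv : B.X ⟶ B.X).left.appLE W W' p x)
    (c : Γ(B.X.left, W)) :
    (show Γ(B.X.left, W') from
        appLE ((tangentSheaf B.X).presheaf.map (homOfLE (le_top : W' ≤ ⊤)).op θ) (𝟙 _) (dSection B.X W' (s c))) =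
      - s (show Γ(B.X.left, W) from
        appLE ((tangentSheaf B.X).presheaf.map (homOfLE (le_top : W ≤ ⊤)).op θ) (𝟙 _) (dSection B.X W c)) := by
  have hs' : ∀ x, s x = B.X.left.presheaf.map (homOfLE p).op ((GrpObj.inv : B.X ⟶ B.X).left.app W x) := fun x => hs x
  rw [hs', hs']
  exact ((map_appLE_map_top_dSection B.X θ p _).symm.trans
    (congrArg (fun x => B.X.left.presheaf.map (homOfLE p).op x) (appLE_dSection_app_inv_eq_neg B θ W c))).trans (map_neg _ _)

set_option maxHeartbeats 400000 in -- two 28-letter data, (vii-d) transport, (O5), (O3), (O4) B: one long assembly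
/-- **[Oort1971] Thm. (2.2.1), first proof: the lift obstruction of an abelian scheme vanishes when `2` is a unit** — the (U-ab) contract
★ `LiftObstructionVanishes hJ hmJ φ X₀` for `A` Artin local, `J` principal small (`J ≠ ⊤`, `𝔪·J = 0`, `φ : J ≅ κ(A)`), `X₀` an abelian scheme of
relative dimension `g` over `Spec (A⧸J)`, `2 ∈ Aˣ`, CONDITIONAL on the `H¹`-count of the canonical closed fibre on its finite affine covers
(`hH1`, the letter of ★ (O4) B `cechMH2_mk_refine_comap_inv_of_finrank_cechH1`) — HONEST LABEL: conditional on `hH1`.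
[cite: Oort1971, Theorem (2.2.1) (p. 273), first proof (pp. 279–280)] [cite: MumfordAV1970, §13 Cor. 2 (p. 129)]
[cite: Hartshorne2010, Thm. 10.2 (a) (proof), p. 81] -/
theorem liftObstructionVanishes_of_isUnit_two (hJ : J ≠ ⊤) (hmJ : IsLocalRing.maximalIdeal A * J = ⊥)
    (φ : ↥J ≃ₗ[A] IsLocalRing.ResidueField A) (X₀ : AbelianSchemeOver (Spec (.of (A ⧸ J)))) {g : ℕ} (hg : X₀.IsOfRelDim g)
    (h2 : IsUnit (2 : A))
    (hH1 : ∀ {ι : Type} [Finite ι] (V : ι → (closedFibre hJ X₀).X.left.Opens), (∀ j, IsAffineOpen (V j)) → iSup V = ⊤ →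
      (closedFibre hJ X₀).toAffine.toAbelianVariety.dim ≤
        Module.finrank (IsLocalRing.ResidueField A) (CechH1 (closedFibre hJ X₀).X.hom V) + 1) :
    LiftObstructionVanishes hJ hmJ φ X₀ := by
  -- the section rings of `X₀` as `A`-algebras through `X₀ → Spec (A⧸J) → Spec A` (the (D) `letI`)
  letI instΓ₀ : ∀ W : X₀.X.left.Opens, Algebra A Γ(X₀.X.left, W) := fun W =>
    (((Scheme.ΓSpecIso (.of (A ⧸ J))).inv ≫ X₀.X.hom.appLE ⊤ W le_top).hom.comp (Ideal.Quotient.mk J)).toAlgebra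
  intro n V c P _ _ _ _ r ψ hV hc hr hkr hψ instκ π hπ δ hδ halgκ hπi hiV hπnat o ho ho₂
  -- names
  have halg₀ := halg_of_structureMorphism (A' := A) X₀.X.hom
  have halg₀' : ∀ (W : X₀.X.left.Opens) (a : A), algebraMap A Γ(X₀.X.left, W) a =
      (X₀.X.hom.appLE ⊤ W le_top) ((Scheme.ΓSpecIso (.of (A ⧸ J))).inv (Ideal.Quotient.mk J a)) := fun W a => rfl
  have hJnil : IsNilpotent J := LiftedLaw.isNilpotent_of_ne_top hJ
  have hκ : Function.Surjective (algebraMap A (IsLocalRing.ResidueField A)) := IsLocalRing.residue_surjective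
  have hφfac : ∀ a : A, Ideal.Quotient.factor (IsLocalRing.le_maximalIdeal hJ) (Ideal.Quotient.mk J a) =
      algebraMap A (IsLocalRing.ResidueField A) a := fun a => rfl
  have h𝔪 : RingHom.ker (algebraMap A (IsLocalRing.ResidueField A)) = IsLocalRing.maximalIdeal A := IsLocalRing.ker_residue
  have H : IsPullback (closedFibreι hJ X₀) (closedFibre hJ X₀).X.hom X₀.X.hom (residueBaseMap hJ) :=
    IsPullback.of_hasPullback X₀.X.hom (residueBaseMap hJ)
  /- (S1) the inversion `σ := ι[X₀.X]` over the base, an isomorphism; its action on sections is `A`-linear -/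
  set σ : X₀.X ⟶ X₀.X := (GrpObj.inv : X₀.X ⟶ X₀.X) with hσdef
  haveI hσiso : IsIso σ := ⟨⟨σ, GrpObj.inv_comp_inv _, GrpObj.inv_comp_inv _⟩⟩
  haveI : IsIso σ.left := inferInstance
  have hσ : ∀ (W' : X₀.X.left.Opens) (a : A), σ.left.app W' (algebraMap A Γ(X₀.X.left, W') a) =
      algebraMap A Γ(X₀.X.left, σ.left ⁻¹ᵁ W') a := app_algebraMap_of_over X₀ σ
  /- (S2a) the transported atlas `D^ι` (★ (vii-d)): cover `σ⁻¹V`, equations `σ♯c`, lifts `σ♯ ∘ r`, gluings `τ ψ τ⁻¹` -/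
  have hV' : ⨆ a, (transportCover σ.left V a).1 = ⊤ := by
    change ⨆ a, σ.left ⁻¹ᵁ (V a).1 = ⊤
    rw [← Scheme.Hom.preimage_iSup, hV, Scheme.Hom.preimage_top]
  have hc' := transportCover_inf_eq_basicOpen σ.left V c hc
  have hr' := transportRed_surjective σ.left hσ V r hr
  have hkr' := ker_transportRed σ.left hσ V r hkr
  have hψ' := reduction_transportGluing halg₀ halg₀ σ.left hσ V r ψ hψ
  /- (S2c) the closed-fibre layer on the transported cover: the pinned `π = pr₁^♯` has the (R8) letters there too (★ (vii-c)) -/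
  obtain ⟨hiV', π', hπi', hπ', -⟩ := exists_closedFibreMaps_atlas hκ J (Ideal.Quotient.factor (IsLocalRing.le_maximalIdeal hJ))
    hφfac X₀.X.hom (closedFibreι hJ X₀) H halg₀' halgκ (IsLocalRing.maximalIdeal A) h𝔪 (transportCover σ.left V)
  have hππ : π' = π := funext fun W => AlgHom.ext fun x => (hπi' W x).trans (hπi W x).symm
  subst hππ
  /- (S2d) the face readings of `D^ι` exist (★ FC-1a `exists_faceReading`) -/
  have hδtex := fun a b d => exists_faceReading J halg₀ hJnil (transportCover σ.left V) (transportEq σ.left V c) hc'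
    (transportRed σ.left hσ V r) hr' hkr' (closedFibreι hJ X₀) (IsLocalRing.maximalIdeal A) hmJ (IsLocalRing.le_maximalIdeal hJ)
    π' hπ' (transportGluing σ.left hσ V r ψ) hψ' a b d
  choose δt hδt using hδtex
  /- (S2b) the closed-fibre identification `s̄ = σ_κ♯` and its pin compatibility -/
  obtain ⟨sbar, hs⟩ := exists_closedFibreTransportEquiv hJ X₀ σ halgκ
  have hsbar : ∀ (W : X₀.X.left.Opens) (x : Γ(X₀.X.left, W)), sbar W (π' W x) = π' (σ.left ⁻¹ᵁ W) (σ.left.app W x) :=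
    sbar_pinned hJ X₀ σ (fun W => π' W) hπi' (fun W => sbar W) hs
  /- (S2e) the transported readings are the `s̄`-conjugates of the original ones (★ (vii-d) `reading_transport`) -/
  have hδδ : ∀ (a b d : Fin n) (x : Γ((closedFibre hJ X₀).X.left, closedFibreι hJ X₀ ⁻¹ᵁ ((V a).1 ⊓ (V b).1 ⊓ (V d).1))),
      δt a b d (sbar _ x) = LinearMap.rTensor ↥J (sbar ((V a).1 ⊓ (V b).1 ⊓ (V d).1)).toLinearMap (δ a b d x) :=
    fun a b d x => reading_transport halg₀ halg₀ σ.left hσ hJnil V c hc r hr hkr ψ hψ (IsLocalRing.maximalIdeal A) π' hπ' π' hπ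
      sbar hsbar hmJ (IsLocalRing.le_maximalIdeal hJ) a b d (hδ a b d) (hδt a b d) x
  /- (S2f) a representing cochain `o'` of the transported readings, closed (★ (vii), ★ (vii-b) B) -/
  obtain ⟨o', ho'⟩ := exists_cochain_rep hκ halgκ J φ
    (fun a => (⟨closedFibreι hJ X₀ ⁻¹ᵁ (transportCover σ.left V a).1, hiV' a⟩ : (closedFibre hJ X₀).X.left.affineOpens))
    (fun a b => (closedFibreι hJ X₀).app (transportCover σ.left V a).1 (transportEq σ.left V c a b))
    (preimage_inf_eq_basicOpen (transportCover σ.left V) (transportEq σ.left V c) hc' (closedFibreι hJ X₀) hiV') δt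
  have ho₂' : o' ∈ cechMZ2 (closedFibre hJ X₀).X.hom (tangentSheaf (closedFibre hJ X₀).X)
      (fun a => closedFibreι hJ X₀ ⁻¹ᵁ (transportCover σ.left V a).1) :=
    (mem_cechMZ2_iff _ _ _ o').2 (cechMD2_eq_zero_of_atlas hκ halgκ J φ halg₀ hJnil (transportCover σ.left V) (transportEq σ.left V c)
      hc' (transportRed σ.left hσ V r) hr' hkr' (closedFibreι hJ X₀) hiV' (IsLocalRing.maximalIdeal A) hmJ
      (IsLocalRing.le_maximalIdeal hJ) π' hπ' hπnat (transportGluing σ.left hσ V r ψ) hψ' δt hδt ho')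
  /- (S3) ★ (O5): the two refined classes agree on a common doubly-principal refinement `W` -/
  obtain ⟨m, W, τ, τ', hτ, hτ', hWcov, pτ, pτ', hiW, hcls⟩ :=
    exists_refinement_cechMH2_mk_refine_eq_of_two_atlases hJ hmJ φ X₀ n V c P r ψ hV hc hr hkr hψ π' hπ δ hδ halgκ hiV hπnat
      o ho ho₂ n (transportCover σ.left V) (transportEq σ.left V c) P (transportRed σ.left hσ V r) (transportGluing σ.left hσ V r ψ)
      hV' hc' hr' hkr' hψ' hπ' δt hδt hiV' o' ho' ho₂'
  /- (S4) a global frame of the tangent sheaf of the closed fibre and the frame coordinates of `o` (★ `CechModuleH2FrameCoordinates`) -/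
  obtain ⟨e⟩ := (closedFibre hJ X₀).nonempty_tangentSheaf_iso_free_of_isLocalRing (hg.baseChange (residueBaseMap hJ))
  have hoc : ∀ a b d, o a b d = ∑ j, (show Γ((closedFibre hJ X₀).X.left,
        closedFibreι hJ X₀ ⁻¹ᵁ (V a).1 ⊓ closedFibreι hJ X₀ ⁻¹ᵁ (V b).1 ⊓ closedFibreι hJ X₀ ⁻¹ᵁ (V d).1) from
        coordC2 (closedFibre hJ X₀).X.hom e (fun a => closedFibreι hJ X₀ ⁻¹ᵁ (V a).1) j o a b d) •
      (tangentSheaf (closedFibre hJ X₀).X).presheaf.map (homOfLE (le_top : closedFibreι hJ X₀ ⁻¹ᵁ (V a).1 ⊓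
        closedFibreι hJ X₀ ⁻¹ᵁ (V b).1 ⊓ closedFibreι hJ X₀ ⁻¹ᵁ (V d).1 ≤ ⊤)).op (frameVec (closedFibre hJ X₀).X.hom e j) :=
    fun a b d => cechMC2_eq_sum_coordC2_smul_frameVec (closedFibre hJ X₀).X.hom e (fun a => closedFibreι hJ X₀ ⁻¹ᵁ (V a).1) o a b d
  /- (O2) the inversion negates the global frame, read through `s̄` — INPUT (LA3-p01) -/
  have hΘ : ∀ (a b d : Fin n) (j : Fin g) (c : Γ((closedFibre hJ X₀).X.left,
        closedFibreι hJ X₀ ⁻¹ᵁ (V a).1 ⊓ closedFibreι hJ X₀ ⁻¹ᵁ (V b).1 ⊓ closedFibreι hJ X₀ ⁻¹ᵁ (V d).1)),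
      (show Γ((closedFibre hJ X₀).X.left, closedFibreι hJ X₀ ⁻¹ᵁ (transportCover σ.left V a).1 ⊓
          closedFibreι hJ X₀ ⁻¹ᵁ (transportCover σ.left V b).1 ⊓ closedFibreι hJ X₀ ⁻¹ᵁ (transportCover σ.left V d).1) from
        appLE ((tangentSheaf (closedFibre hJ X₀).X).presheaf.map (homOfLE (le_top :
          closedFibreι hJ X₀ ⁻¹ᵁ (transportCover σ.left V a).1 ⊓ closedFibreι hJ X₀ ⁻¹ᵁ (transportCover σ.left V b).1 ⊓
            closedFibreι hJ X₀ ⁻¹ᵁ (transportCover σ.left V d).1 ≤ ⊤)).op (frameVec (closedFibre hJ X₀).X.hom e j)) (𝟙 _)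
          (dSection (closedFibre hJ X₀).X _ (sbar ((V a).1 ⊓ (V b).1 ⊓ (V d).1) c))) =
      - sbar ((V a).1 ⊓ (V b).1 ⊓ (V d).1) (show Γ((closedFibre hJ X₀).X.left,
          closedFibreι hJ X₀ ⁻¹ᵁ (V a).1 ⊓ closedFibreι hJ X₀ ⁻¹ᵁ (V b).1 ⊓ closedFibreι hJ X₀ ⁻¹ᵁ (V d).1) from
        appLE ((tangentSheaf (closedFibre hJ X₀).X).presheaf.map (homOfLE (le_top : closedFibreι hJ X₀ ⁻¹ᵁ (V a).1 ⊓
          closedFibreι hJ X₀ ⁻¹ᵁ (V b).1 ⊓ closedFibreι hJ X₀ ⁻¹ᵁ (V d).1 ≤ ⊤)).op (frameVec (closedFibre hJ X₀).X.hom e j)) (𝟙 _)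
          (dSection (closedFibre hJ X₀).X _ c)) := fun a b d j c =>
    appLE_dSection_eq_neg_of_eq_appLE_inv (closedFibre hJ X₀) (frameVec (closedFibre hJ X₀).X.hom e j)
      (closedFibreι hJ X₀ ⁻¹ᵁ (V a).1 ⊓ closedFibreι hJ X₀ ⁻¹ᵁ (V b).1 ⊓ closedFibreι hJ X₀ ⁻¹ᵁ (V d).1)
      (closedFibreι hJ X₀ ⁻¹ᵁ (transportCover σ.left V a).1 ⊓ closedFibreι hJ X₀ ⁻¹ᵁ (transportCover σ.left V b).1 ⊓
        closedFibreι hJ X₀ ⁻¹ᵁ (transportCover σ.left V d).1) _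
      (sbar ((V a).1 ⊓ (V b).1 ⊓ (V d).1)) (hs ((V a).1 ⊓ (V b).1 ⊓ (V d).1)) c
  /- (O3) the frame cochain represents the transported readings; by uniqueness it IS `o'` -/
  have hõ := cochain_frame_rep J φ
    (fun a => (⟨closedFibreι hJ X₀ ⁻¹ᵁ (V a).1, hiV a⟩ : (closedFibre hJ X₀).X.left.affineOpens))
    (fun a => (⟨closedFibreι hJ X₀ ⁻¹ᵁ (transportCover σ.left V a).1, hiV' a⟩ : (closedFibre hJ X₀).X.left.affineOpens))
    (fun a b d => sbar ((V a).1 ⊓ (V b).1 ⊓ (V d).1))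
    (fun j => frameVec (closedFibre hJ X₀).X.hom e j) (fun j => frameVec (closedFibre hJ X₀).X.hom e j) hΘ
    (fun j => coordC2 (closedFibre hJ X₀).X.hom e (fun a => closedFibreι hJ X₀ ⁻¹ᵁ (V a).1) j o) hoc hδδ ho
  have hoo := cochain_rep_unique hκ halgκ J φ
    (fun a => (⟨closedFibreι hJ X₀ ⁻¹ᵁ (transportCover σ.left V a).1, hiV' a⟩ : (closedFibre hJ X₀).X.left.affineOpens))
    (fun a b => (closedFibreι hJ X₀).app (transportCover σ.left V a).1 (transportEq σ.left V c a b))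
    (preimage_inf_eq_basicOpen (transportCover σ.left V) (transportEq σ.left V c) hc' (closedFibreι hJ X₀) hiV') ho' hõ
  /- (S5) the endgame: per frame coordinate, `[ρ_{τ′}(ι_κ^* o^j)] = −[ρ_τ o^j]` ((O5) + frame coordinates), hence `[o^j] = 0` (★ (O4c)),
     hence `[o] = 0` (★ `CechMH2.mk_eq_zero_of_coordC2`). -/
  have hinv : AbelianVarietyCech.inv (closedFibre hJ X₀) =
      pullback.lift (closedFibreι hJ X₀ ≫ σ.left) (pullback.snd X₀.X.hom (residueBaseMap hJ)) (fst_comp_left_comp_hom hJ X₀ σ) := rfl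
  have hU₁cov : ⨆ a, ((⟨closedFibreι hJ X₀ ⁻¹ᵁ (V a).1, hiV a⟩ : (closedFibre hJ X₀).X.left.affineOpens)).1 = ⊤ := by
    change ⨆ a, closedFibreι hJ X₀ ⁻¹ᵁ (V a).1 = ⊤
    rw [← Scheme.Hom.preimage_iSup, hV, Scheme.Hom.preimage_top]
  have hWκcov : ⨆ s, ((⟨closedFibreι hJ X₀ ⁻¹ᵁ (W s).1, hiW s⟩ : (closedFibre hJ X₀).X.left.affineOpens)).1 = ⊤ := by
    change ⨆ s, closedFibreι hJ X₀ ⁻¹ᵁ (W s).1 = ⊤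
    rw [← Scheme.Hom.preimage_iSup, hWcov, Scheme.Hom.preimage_top]
  have hUW : ∀ a, ((⟨closedFibreι hJ X₀ ⁻¹ᵁ (V a).1, hiV a⟩ : (closedFibre hJ X₀).X.left.affineOpens)).1 ≤
      ⨆ s, ((⟨closedFibreι hJ X₀ ⁻¹ᵁ (W s).1, hiW s⟩ : (closedFibre hJ X₀).X.left.affineOpens)).1 := fun a => by
    rw [hWκcov]; exact le_top
  have hτκ : ∀ s, ((⟨closedFibreι hJ X₀ ⁻¹ᵁ (W s).1, hiW s⟩ : (closedFibre hJ X₀).X.left.affineOpens)).1 ≤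
      ((⟨closedFibreι hJ X₀ ⁻¹ᵁ (V (τ s)).1, hiV (τ s)⟩ : (closedFibre hJ X₀).X.left.affineOpens)).1 :=
    fun s => (closedFibreι hJ X₀).preimage_mono (hτ s)
  have hτκ' : ∀ s, ((⟨closedFibreι hJ X₀ ⁻¹ᵁ (W s).1, hiW s⟩ : (closedFibre hJ X₀).X.left.affineOpens)).1 ≤
      AbelianVarietyCech.inv (closedFibre hJ X₀) ⁻¹ᵁ ((⟨closedFibreι hJ X₀ ⁻¹ᵁ (V (τ' s)).1, hiV (τ' s)⟩ :
        (closedFibre hJ X₀).X.left.affineOpens)).1 := fun s => by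
    change closedFibreι hJ X₀ ⁻¹ᵁ (W s).1 ≤ AbelianVarietyCech.inv (closedFibre hJ X₀) ⁻¹ᵁ (closedFibreι hJ X₀ ⁻¹ᵁ (V (τ' s)).1)
    rw [hinv, ← preimage_preimage_eq hJ X₀ σ]
    exact (closedFibreι hJ X₀).preimage_mono (hτ' s)
  have h2κ : IsUnit (2 : IsLocalRing.ResidueField A) := by
    have := h2.map (algebraMap A (IsLocalRing.ResidueField A))
    rwa [map_ofNat] at this
  have hcoord0 : ∀ j : Fin g, CechMH2.mk (closedFibre hJ X₀).X.hom (unitModule (closedFibre hJ X₀).X.left)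
      (fun a => closedFibreι hJ X₀ ⁻¹ᵁ (V a).1)
      ⟨coordC2 (closedFibre hJ X₀).X.hom e (fun a => closedFibreι hJ X₀ ⁻¹ᵁ (V a).1) j o,
        coordC2_mem_cechMZ2 (closedFibre hJ X₀).X.hom e (fun a => closedFibreι hJ X₀ ⁻¹ᵁ (V a).1) j ho₂⟩ = 0 := by
    intro j
    refine cechMH2_mk_eq_zero_of_refine_comap_inv_eq_neg_of_finrank_cechH1 (closedFibre hJ X₀)
      (fun a => (⟨closedFibreι hJ X₀ ⁻¹ᵁ (V a).1, hiV a⟩ : (closedFibre hJ X₀).X.left.affineOpens)) hU₁cov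
      ⟨coordC2 (closedFibre hJ X₀).X.hom e (fun a => closedFibreι hJ X₀ ⁻¹ᵁ (V a).1) j o,
        coordC2_mem_cechMZ2 (closedFibre hJ X₀).X.hom e (fun a => closedFibreι hJ X₀ ⁻¹ᵁ (V a).1) j ho₂⟩
      (fun s => (⟨closedFibreι hJ X₀ ⁻¹ᵁ (W s).1, hiW s⟩ : (closedFibre hJ X₀).X.left.affineOpens)) τ τ' hτκ hτκ' hUW h2κ hH1 ?_
    -- the antisymmetry letter for the `j`-th coordinate
    refine CechMH2.mk_refine_eq_neg_of_coordC2 (closedFibre hJ X₀).X.hom e (fun a => closedFibreι hJ X₀ ⁻¹ᵁ (V a).1)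
      (fun a => closedFibreι hJ X₀ ⁻¹ᵁ (transportCover σ.left V a).1)
      (preimageFamily (AbelianVarietyCech.inv (closedFibre hJ X₀)) (fun a => closedFibreι hJ X₀ ⁻¹ᵁ (V a).1))
      (fun s => closedFibreι hJ X₀ ⁻¹ᵁ (W s).1) τ τ' (fun s => (closedFibreι hJ X₀).preimage_mono (hτ s))
      (fun s => (closedFibreι hJ X₀).preimage_mono (hτ' s)) hτκ' ⟨o, ho₂⟩ ⟨o', ho₂'⟩ hcls j _
      (comapC2_mem_cechMZ2 (closedFibre hJ X₀).X.hom (closedFibre hJ X₀).X.hom (AbelianVarietyCech.inv (closedFibre hJ X₀))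
        (Over.w (GrpObj.inv : (closedFibre hJ X₀).X ⟶ (closedFibre hJ X₀).X)) (fun a => closedFibreι hJ X₀ ⁻¹ᵁ (V a).1)
        (coordC2_mem_cechMZ2 (closedFibre hJ X₀).X.hom e (fun a => closedFibreι hJ X₀ ⁻¹ᵁ (V a).1) j ho₂)) ?_
    -- the coefficient identity: `ρ_{τ′}(π_j o′) = −ρ_{τ′}(ι_κ^* π_j o)` — `o′` has frame coordinates `−s̄(π_j o)` and `s̄ = ι_κ♯`
    -- `π_j o′ = −s̄(π_j o)`: the frame coordinates of the (O3) representative `o′ = −∑_j s̄(π_j o) • Θ_j|`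
    have hcj : coordC2 (closedFibre hJ X₀).X.hom e (fun a => closedFibreι hJ X₀ ⁻¹ᵁ (transportCover σ.left V a).1) j o' =
        -(fun a b d => show Morphisms.Sections (closedFibre hJ X₀).X.hom (closedFibreι hJ X₀ ⁻¹ᵁ (transportCover σ.left V a).1 ⊓ closedFibreι hJ X₀ ⁻¹ᵁ (transportCover σ.left V b).1 ⊓
            closedFibreι hJ X₀ ⁻¹ᵁ (transportCover σ.left V d).1) from sbar ((V a).1 ⊓ (V b).1 ⊓ (V d).1)
          (show Γ((closedFibre hJ X₀).X.left, closedFibreι hJ X₀ ⁻¹ᵁ (V a).1 ⊓ closedFibreι hJ X₀ ⁻¹ᵁ (V b).1 ⊓ closedFibreι hJ X₀ ⁻¹ᵁ (V d).1) from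
            coordC2 (closedFibre hJ X₀).X.hom e (fun a => closedFibreι hJ X₀ ⁻¹ᵁ (V a).1) j o a b d)) := by
      rw [← neg_eq_iff_eq_neg, ← map_neg]
      exact coordC2_eq_of_eq_sum (closedFibre hJ X₀).X.hom e (fun a => closedFibreι hJ X₀ ⁻¹ᵁ (transportCover σ.left V a).1) (-o')
        (fun j' a b d => show Morphisms.Sections (closedFibre hJ X₀).X.hom (closedFibreι hJ X₀ ⁻¹ᵁ (transportCover σ.left V a).1 ⊓ closedFibreι hJ X₀ ⁻¹ᵁ (transportCover σ.left V b).1 ⊓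
            closedFibreι hJ X₀ ⁻¹ᵁ (transportCover σ.left V d).1) from sbar ((V a).1 ⊓ (V b).1 ⊓ (V d).1)
          (show Γ((closedFibre hJ X₀).X.left, closedFibreι hJ X₀ ⁻¹ᵁ (V a).1 ⊓ closedFibreι hJ X₀ ⁻¹ᵁ (V b).1 ⊓ closedFibreι hJ X₀ ⁻¹ᵁ (V d).1) from
            coordC2 (closedFibre hJ X₀).X.hom e (fun a => closedFibreι hJ X₀ ⁻¹ᵁ (V a).1) j' o a b d))
        (fun a b d => by
          have h3 : -(o' a b d) = _ := congrArg Neg.neg (congrFun (congrFun (congrFun hoo a) b) d)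
          exact h3.trans (neg_neg _)) j
    rw [hcj, map_neg, neg_inj]
    funext s t u
    rw [cechMRefineC2_apply, cechMRefineC2_apply, cechComapC2_apply, MSections.res_unit, MSections.res_unit, hs]
    exact Sections.res_appLE_eq_res_comap _ _ _ _ _ _ _ _ _
  exact CechMH2.mk_eq_zero_of_coordC2 (closedFibre hJ X₀).X.hom e (fun a => closedFibreι hJ X₀ ⁻¹ᵁ (V a).1) ⟨o, ho₂⟩ hcoord0

end Literature.AlgebraicGeometry.AbelianSchemes.AbelianSchemeOver

end
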